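import Summits.BirchSwinnertonDyer.Rank1Residual.Additive.RamifiedSevenGenusResidue
import Literature.NumberTheory.IwasawaTheory.IwasawaAlgebraProjectiveLimit
import Literature.NumberTheory.IwasawaTheory.StickelbergerSeriesExistence
import HarnessLib

/-!
# `𝒞₇` genus road, row (GENUS-PORT-A) blocks (B2′)+(B5): the ORIENTED factorisation shape of crux K1ᵘ
# (`Θ` pinned as the memo defines it — the Stickelberger elements `Σ⟨a/N⟩σ_a⁻¹` read on the `η₁`-line),
# the genus residue (G6) from it, the determinacy of the datum's `Λ`-elements, and the (B5) report

Cell bsd-cm, seat bsd-cm-k-ty1 g23; scope `SCOPE-GENUS-PORT-F8.md` (16530c741a99cc96) blocks (B2), (B5); memo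
`MEMO-bsd-cm-genus` v1 (a38f3eedd2c92d58; REV 1.2) §2 (P4), §6 (G4), §7 (G5) = crux K1ᵘ and (G5′)(e), §8 (G6).
APPEND-ONLY successor of the shapes file `RamifiedSevenGenusFactorisationShape.lean` (whose structures are frozen):
nothing there is changed; this file ADDS the oriented datum and shape and re-proves (G6) for them.  HONEST LABEL:
K1ᵘ is NOT proved here; no item closes; no stub is registered (the closed ∀/∃-forms are the pen's);
stmt-BirchSwinnertonDyer-19945 is OPEN; `X12.CMRamifiedSeven` is NOT proved; BSD is claimed for no curve.

## ORIENTATION (memo (G5′)(e)) — why a second pin of `Θ`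

F4's pinned datum makes `Λ = ℤ₇⟦T⟧` act on `𝓤` with `1 + T = γ₀` (pin (T): `rep n ((1+T)•m) = γ₀·rep n m`,
`χ_cyc(γ₀) = u`), so `P ∈ Λ` acts on the `e_{η₁κ}`-component (`κ` a character of `Γ_n`, read as a Dirichlet character
by `κ(a) = κ(σ_a)`) by the scalar `P(κ(γ₀) − 1)`.  Memo K1ᵘ (from (G4): the `e_{η₁κ}`-multiplier is
`−½(N𝔞 − η₁κ(N𝔞))·B_{1,\overline{η₃κ}}`, `\overline{η₃κ} = ω⁴χ_D·κ̄`; (P4): `θ(m) = Σ⟨a/m⟩σ_a⁻¹`, `e_ψθ(m) = B_{1,ψ̄}e_ψ`)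
therefore needs `Θ(κ(γ₀) − 1) = B_{1,ω⁴χ_Dκ̄}`.  Lang's `f = f_{η₁,1}` built with the generator `γ = u` (Ch. 10 Thm 1.2
(2)–(3): `(1+X)^{r(a)}`, `u^{r(a)} = ⟨a⟩`, i.e. `γ₀^{r(a)} = σ_a|_Γ`) has `f(κ(γ₀) − 1) = B_{1,ω⁴χ_Dκ}` (Cor. 1 of Thm 1.2
with `ψ(a) = ψ(⟨a⟩)`, `ζ_ψ = ψ(u)`).  The two differ by `ι : (1+T) ↦ (1+T)⁻¹`; the K1ᵘ-correct `Θ` is Lang's recipe for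
the generator `u⁻¹`: exponents `t` with `(u⁻¹)^{t}ω(a) ≡ a`, i.e. `γ₀^{t} = σ_a⁻¹|_Γ` — the `γ`-log table
`GenusFrame.rInv n a = (7ⁿ − 1)·r n a` of `u⁻¹` DERIVED from the frame's table `r` (no new frame field;
`rInv_logTable` PROVED).  The `x`-pin (`N𝔞 − η₁(N𝔞)(1+T)^{r_j(N𝔞)}`, `γ₀^{r} = σ_{N𝔞}|_Γ`) is (G4)'s unbarred factor
`N𝔞 − χ(σ_{N𝔞})` and keeps the table `r`.  Since `7 ∣ P ⇔ 7 ∣ ιP`, the landed (B2) theorem over the first shape is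
valid as it stands; what the orientation decides is WHICH closed form of K1ᵘ is true on the elliptic data, and that is
the ORIENTED one below.

## Objects ADDED (names new; the frozen names of the shapes file are untouched and REUSED)

* `GenusFrame.rInv`, `GenusFrame.rInv_logTable`, `GenusFrame.isTopGenerator_u_inv` (`‖u⁻¹ − 1‖ = 7⁻¹`).
* `structure OrientedGenusDatum F θu extends GenusDatum F θu` by `Θm : Λ`,
  `Θm_spec : IsStickelbergerSeries 7 F.d F.oddBranchSeven F.rInv Θm` (the parent's `Θ`, Lang's orientation, is not
  used by the oriented shape; it is determined by the frame, `GenusDatum.Theta_eq`, and exists by the same theorem).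
* `OrientedGenusDatum.genusFactorM d = C(−½)·C(ub)·x·Θm` (both constants VISIBLE), `OrientedGenusFactorisationShape d :≡
  θ = genusFactorM • ξ` — crux K1ᵘ's identity as the memo means it; the residue predicate is the frozen
  `GenusResidueNonzeroShape d.toGenusDatum` (row B's input is unchanged).
* (B2′) `orientedGenusFactorisationShape_imp_genusResidueNonzeroShape h₄ h₂ h₂' :
  ∀ F θu (d : OrientedGenusDatum F θu), OrientedGenusFactorisationShape d → GenusResidueNonzeroShape d.toGenusDatum`
  (same proof road: Tsuji's Coleman map at the frame, LEMMA M, Ferrero–Washington twice, `7` prime in `Λ`).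
* (B5) determinacy `GenusDatum.x_eq`, `GenusDatum.Theta_eq`, `OrientedGenusDatum.Thetam_eq`, `genusFactorM_eq` (planner
  D880: «`⋂ₙ(hₙ) = 0` makes it unique — prove the uniqueness lemma»; `IsStickelbergerSeries.unique`), and the glue
  `exists_genusResidueNonzero_of_orientedK1u` from the pen's closed form of K1ᵘ to the residue.

## (B5) REPORT — the residual of K1ᵘ after row (GENUS-PORT-A) (audit items (a)–(e) of memo §7)

K1ᵘ in the tree's currency is the closed form `∀ (F : GenusFrame) θu, <row B's pin of θu> → ∃ d : OrientedGenusDatum F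
θu, OrientedGenusFactorisationShape d`.  Producing the witness requires, field by field: `Θm`/`Θ` — EXISTENCE of
Iwasawa's Stickelberger series (Lang Ch. 10 Thm 1.2, the measure `α_*(θω⁻¹E₁)`; the tree has the finite-level elements
with integrality and character values PROVED in `GaussSums/StickelbergerElement.lean`, NOT the passage to `Λ`) — audit
item (d)/(e); `x` — the `7`-adic limit `(1+T)^{t}`, `u^{t} = ⟨N𝔞⟩` (routine, untyped); `e`, `θraw`, `ξraw`, `ξu_val` —
infrastructure on F4's pinned `𝓤` (the finite `Υ`-action for `e_{η₁} = 12⁻¹Σ η₁(g)⁻¹g`; the norm relations of the two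
global families, Kato §15.5 and F3's PROVED distribution relation) — item (d) «coherence»; `cycChi_eq_span` — Sinnott's
bookkeeping `e_{η₁}𝒞 = Λ·e_{η₁}ξ` (memo (P5); Tsuji §6) — untyped; the IDENTITY — (G4) at every finite level
(Kronecker's limit formula = F5 fact `kato1551_kroneckerLimitFormula` with `−½`; Artin factorisation A7 PROVED; LEMMA C;
the `s = 0` classical formulas: A8 PROVED, F3's `s = 1` form PROVED, the functional-equation passage untyped; regulator
injectivity on the `χ`-line A9 PROVED) and the `Λ`-adic passage §7 (b) integrality (F2, PROVED at finite level), (c)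
torsion-freeness of `e_{η₁}(E_n ⊗ ℤ₇)`, (d) coherence — items (a)–(d).  NONE of these steps is typed as a map between
the tree's objects (`χ`-logarithms on `E(K_n) ⊗ ℚ̄`; the push `E(K_n) ⊗ ℤ₇ → 𝓤_{K_n}`), so no single item «resists» in
isolation: the ASSEMBLY ITSELF is the residual, and the honest registered stub is K1ᵘ in the closed form above.  PROVED
by row A of the K1ᵘ → K2 road: (G6) for every frame/datum in both orientations, LEMMA M (`μ(x) = 0`), `μ(Θ) = μ(Θm) =
0` from the vendored Ferrero–Washington, the determinacy of `x`, `Θ`, `Θm`, `G_𝔞`, and the glue below.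

## References
Memo §2, §6–§8; scope F8; S. Lang, Cyclotomic Fields I–II (1990) Ch. 5 §1 Thm 1.1, Ch. 10 §1 Thm 1.2 + Cor. 1, §2
(2)–(3), Thm 2.3 [Lang1990]; T. Tsuji, J. Number Theory 78 (1999) §3 Thm 3.1, §6 [Tsuji1999]; K. Kato, Astérisque 295
(2004) §15.5–15.6 [Kato2004Asterisque]; B. Ferrero, L. Washington, Ann. of Math. 109 (1979) [FerreroWashington1979].
-/

noncomputable section

open scoped NumberField
open PowerSeries IsDedekindDomain
open Literature.NumberTheory.EllipticCurves
open Literature.NumberTheory.EllipticCurves.IwasawaAlgebra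
open Literature.NumberTheory.IwasawaTheory
open Literature.NumberTheory.IwasawaTheory.StickelbergerSeries
open Literature.NumberTheory.ComplexMultiplication.EllipticUnits

namespace Summit.BirchSwinnertonDyer.Rank1Residual.Additive.GenusSeven

/-! ## §1 The `γ`-log table of `u⁻¹` derived from the frame's table of `u` -/

namespace GenusFrame

variable (F : GenusFrame)

/-- **The `γ`-log table of `u⁻¹`**: `rInv n a = (7ⁿ − 1)·r n a`, so that `(u⁻¹)^{rInv n a}·ω(a) ≡ a (mod 7^{n+1})`
(`⟨a⟩^{7ⁿ} ≡ 1`), i.e. `γ₀^{rInv n a}|_{K_n} = σ_a⁻¹|_Γ` — the exponents of the INVERSE Artin symbols of the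
Stickelberger elements `θ(N) = Σ⟨a/N⟩σ_a⁻¹` (module docstring «ORIENTATION»).
[cite: Lang1990, Ch. 10 §1 Thm 1.2 (PDF p. 168, «r(a) such that r(a) ≡ α(a) mod p^n», «⟨a⟩ = γ^{α(a)}»)] -/
def rInv (n a : ℕ) : ℕ := (7 ^ n - 1) * F.r n a

/-- Unfolding `rInv`. [cite: Lang1990, Ch. 10 §1 Thm 1.2 (PDF p. 168)] -/
theorem rInv_def (n a : ℕ) : F.rInv n a = (7 ^ n - 1) * F.r n a := rfl

/-- **`rInv` is a `γ`-log table for the generator `u⁻¹`.**  Proof: `(u⁻¹)^{(7ⁿ−1)r}·u^{7ⁿr} = u^{r}` and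
`u^{7ⁿr} ≡ 1 (mod 7^{n+1})` (`u ≡ 1 mod 7`), so `(u⁻¹)^{rInv}ω(a) ≡ u^{r}ω(a) ≡ a`.
[cite: Lang1990, Ch. 10 §1 Thm 1.2 (PDF p. 168)] -/
theorem rInv_logTable : IsLogTable 7 ((F.u⁻¹ : ℤ_[7]ˣ) : ℤ_[7]) F.ω F.rInv := by
  intro n a ha
  have h1 := F.r_logTable n a ha
  have h2 : (F.u : ℤ_[7]) ^ (7 ^ n * F.r n a) - 1 ∈ Ideal.span {((7 : ℕ) : ℤ_[7]) ^ (n + 1)} :=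
    pow_sub_one_mem_span_of_dvd F.seven_dvd_u_sub_one (Dvd.intro _ rfl)
  have key : ((F.u⁻¹ : ℤ_[7]ˣ) : ℤ_[7]) ^ F.rInv n a * (F.u : ℤ_[7]) ^ (7 ^ n * F.r n a) =
      (F.u : ℤ_[7]) ^ F.r n a := by
    have h7 : 7 ^ n * F.r n a = (7 ^ n - 1) * F.r n a + F.r n a := by
      rw [Nat.sub_one_mul, Nat.sub_add_cancel (Nat.le_mul_of_pos_left (F.r n a) (by positivity))]
    rw [rInv_def, h7, pow_add, ← mul_assoc, ← mul_pow, Units.inv_mul, one_pow, one_mul]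
  have h3 : ((F.u⁻¹ : ℤ_[7]ˣ) : ℤ_[7]) ^ F.rInv n a * F.ω (a : ZMod 7) - (a : ℤ_[7]) =
      -(((F.u⁻¹ : ℤ_[7]ˣ) : ℤ_[7]) ^ F.rInv n a * F.ω (a : ZMod 7)) * ((F.u : ℤ_[7]) ^ (7 ^ n * F.r n a) - 1) +
        ((F.u : ℤ_[7]) ^ F.r n a * F.ω (a : ZMod 7) - (a : ℤ_[7])) := by
    linear_combination (F.ω (a : ZMod 7)) * key
  rw [h3]
  exact Ideal.add_mem _ (Ideal.mul_mem_left _ _ h2) h1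

/-- **`u⁻¹` is a topological generator of `1 + 7ℤ₇`** (`‖u⁻¹ − 1‖ = ‖u⁻¹‖·‖1 − u‖ = 7⁻¹`).
[cite: Lang1990, Ch. 10 §1 (PDF p. 167, «γ a fixed topological generator»)] -/
theorem isTopGenerator_u_inv : KubotaLeopoldt.IsTopGenerator 7 ((F.u⁻¹ : ℤ_[7]ˣ) : ℤ_[7]) := by
  have h : ((F.u⁻¹ : ℤ_[7]ˣ) : ℤ_[7]) - 1 = ((F.u⁻¹ : ℤ_[7]ˣ) : ℤ_[7]) * (1 - (F.u : ℤ_[7])) := by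
    rw [mul_sub, mul_one, Units.inv_mul]
  rw [KubotaLeopoldt.IsTopGenerator, h, norm_mul, PadicInt.norm_units, one_mul, norm_sub_rev]
  exact F.u_topGenerator

end GenusFrame

/-! ## §2 The oriented datum and shape (crux K1ᵘ as the memo means it) -/

/-- **An ORIENTED genus datum**: a `GenusDatum F θu` together with `Θm ∈ Λ`, the Stickelberger series of the odd branch
`ω⁴χ_D` pinned in the `γ`-log table `rInv` of `u⁻¹` — the `e_{η₁}`-reading of `θ(N) = Σ⟨a/N⟩σ_a⁻¹` (memo (P4), §7 (b),
(d)), `κ`-components `B_{1,ω⁴χ_Dκ̄}` (module docstring «ORIENTATION»).  HYPOTHESIS STRUCTURE; nothing is asserted to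
exist; the closed form «every pinned `(F, θu)` carries such a datum with `OrientedGenusFactorisationShape`» is crux K1ᵘ
and is NOT stated here. [cite: Lang1990, Ch. 10 §1 Thm 1.2, §2 (2)–(3) (PDF pp. 168, 171)] [cite: Kato2004Asterisque, §15.5–15.6 (pp. 253–254)] -/
structure OrientedGenusDatum (F : GenusFrame) (θu : ∀ n : ℕ, globalUnitsOf (F.layer n)) : Type
    extends GenusDatum F θu where
  /-- `Θm ∈ Λ`: the Stickelberger series of `ω⁴χ_D` in the MEMO's orientation (table `rInv` of `u⁻¹`). -/
  Θm : IwasawaAlgebra 7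
  Θm_spec : IsStickelbergerSeries 7 F.d F.oddBranchSeven F.rInv Θm

namespace OrientedGenusDatum

variable {F : GenusFrame} {θu : ∀ n : ℕ, globalUnitsOf (F.layer n)} (d : OrientedGenusDatum F θu)

/-- **`G_𝔞 = −½ · u · (N𝔞 − σ_{N𝔞}) · Θm ∈ Λ`** — the genus factor of crux K1ᵘ in the memo's orientation (`c₀ = −½`
[REV 1.1] and the branch unit `u`, both VISIBLE). [cite: Kato2004Asterisque, §15.5 (15.5.1) and §15.6 (pp. 253–254)] [cite: Lang1990, Ch. 10 §2 (2)–(3) (PDF p. 171)] -/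
def genusFactorM : IwasawaAlgebra 7 :=
  C GenusDatum.cZero * C ((d.ub : ℤ) : ℤ_[7]) * d.x * d.Θm

/-- Unfolding `genusFactorM`. [cite: Kato2004Asterisque, §15.5–15.6 (pp. 253–254)] -/
theorem genusFactorM_def : d.genusFactorM = C GenusDatum.cZero * C ((d.ub : ℤ) : ℤ_[7]) * d.x * d.Θm := rfl

end OrientedGenusDatum

/-- **`OrientedGenusFactorisationShape d` — crux K1ᵘ `GenusFactorisationLambdaAdic` as a predicate on an oriented
datum**: in `𝓤^{η₁}`, `e_{η₁}θ^{𝔞} = G_𝔞 · e_{η₁}ξ` with `G_𝔞 = −½·u·x·Θm` (memo §7; «ORIENTATION»).  A predicate;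
nothing asserted. [cite: Kato2004Asterisque, §15.5 (15.5.1) (p. 253)] [cite: Lang1990, Ch. 10 §2 (2)–(3) (PDF p. 171)] -/
def OrientedGenusFactorisationShape {F : GenusFrame} {θu : ∀ n : ℕ, globalUnitsOf (F.layer n)}
    (d : OrientedGenusDatum F θu) : Prop :=
  d.θ = d.genusFactorM • d.ξ

/-! ## §3 (B2′) the genus residue (G6) from the oriented factorisation -/

section Residue

variable {F : GenusFrame} {θu : ∀ n : ℕ, globalUnitsOf (F.layer n)} (d : OrientedGenusDatum F θu)

/-- **Ferrero–Washington (Lang's `ψ`-direction) for `Θm`: `7 ∤ Θm`** (the vendored fact at the generator `u⁻¹` and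
its table `rInv`). [cite: Lang1990, Ch. 10 §2 Thm. 2.3 (PDF p. 172)] [cite: FerreroWashington1979, Theorem (p. 377)] -/
theorem OrientedGenusDatum.not_C_seven_dvd_Thetam (h₂' : ferreroWashington_stickelbergerSeries_unitCoeff) :
    ¬ (C (7 : ℤ_[7]) : IwasawaAlgebra 7) ∣ d.Θm := by
  have h := ferreroWashington_stickelbergerSeries_unitCoeff.not_C_dvd h₂' (p := 7) (by decide) F.d_pos
    F.d_coprime_seven F.etaOneDirichlet_ne_one F.etaOneDirichlet_even F.etaOneDirichlet_conductor F.ω_teichmuller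
    F.isTopGenerator_u_inv F.rInv_logTable d.Θm_spec
  rwa [show ((7 : ℕ) : ℤ_[7]) = 7 by norm_cast] at h

/-- The oriented genus factor is `μ`-free: `7 ∤ G_𝔞 = c₀·u·x·Θm` (units `c₀ = −½`, `u`; LEMMA M; Ferrero–Washington).
[cite: Lang1990, Ch. 10 §2 Thm. 2.3 (PDF p. 172)] [cite: Kato2004Asterisque, §15.6 (p. 254)] -/
theorem OrientedGenusDatum.not_C_seven_dvd_genusFactorM (h₂' : ferreroWashington_stickelbergerSeries_unitCoeff) :
    ¬ (C (7 : ℤ_[7]) : IwasawaAlgebra 7) ∣ d.genusFactorM := by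
  have hP := prime_C_seven
  rw [OrientedGenusDatum.genusFactorM_def]
  intro h
  rcases hP.dvd_or_dvd h with h | h
  · rcases hP.dvd_or_dvd h with h | h
    · rcases hP.dvd_or_dvd h with h | h
      · exact hP.not_unit (isUnit_of_dvd_unit h (GenusDatum.isUnit_cZero.map C))
      · exact hP.not_unit (isUnit_of_dvd_unit h (d.isUnit_ub.map C))
    · exact d.not_C_seven_dvd_x h
  · exact d.not_C_seven_dvd_Thetam h₂' h

/-- **Coleman detects `7`-divisibility** for the oriented identity: if `e_{η₁}θ^𝔞 = 7·y` in `𝓤^{η₁}` then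
`7 ∣ G_𝔞·g_{η₁}` in `Λ`. [cite: Tsuji1999, Thm. 3.1 (i) (p. 6)] -/
theorem OrientedGenusDatum.C_seven_dvd_genusFactorM_mul_g (h₄ : tsuji1999_thm31_colemanMap)
    (hK1 : OrientedGenusFactorisationShape d) {y : F.U.chiPart F.η₁}
    (hy : d.θ = (C (7 : ℤ_[7]) : IwasawaAlgebra 7) • y) :
    (C (7 : ℤ_[7]) : IwasawaAlgebra 7) ∣ d.genusFactorM * F.g := by
  obtain ⟨Col, hCol⟩ := F.exists_colemanMap h₄
  rw [d.cycChi_eq_span, Submodule.map_span, Set.image_singleton] at hCol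
  obtain ⟨w, hw⟩ := Ideal.span_singleton_eq_span_singleton.mp hCol
  have h1 : Col d.θ = d.genusFactorM * Col d.ξ := by rw [hK1, map_smul, smul_eq_mul]
  have h2 : Col d.θ = C (7 : ℤ_[7]) * Col y := by rw [hy, map_smul, smul_eq_mul]
  refine ⟨Col y * w, ?_⟩
  calc d.genusFactorM * F.g = d.genusFactorM * (Col.toLinearMap d.ξ * w) := by rw [hw]
    _ = Col d.θ * w := by rw [LinearEquiv.coe_coe, h1, mul_assoc]
    _ = C (7 : ℤ_[7]) * (Col y * w) := by rw [h2, mul_assoc]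

/-- **(B2′) THE GENUS RESIDUE FROM THE ORIENTED FACTORISATION** (memo §8 (G6) + LEMMA M): for every `𝒞₇`-frame, every
global family `θu` and every oriented datum `d`, K1ᵘ's identity `e_{η₁}θ^𝔞 = G_𝔞·e_{η₁}ξ` implies that the class of
`e_{η₁}θ^𝔞` in `𝓤^{η₁}/7𝓤^{η₁}` is non-zero — GIVEN Tsuji 1999 Thm 3.1 (i) and Ferrero–Washington in its two printed
readings.  Conditional theorem; nothing about BSD is claimed.
[cite: Tsuji1999, Thm. 3.1 (i) (p. 6)] [cite: Lang1990, Ch. 10 §2 Thm. 2.3 (PDF p. 172)] [cite: FerreroWashington1979, Theorem (p. 377)] -/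
theorem genusResidueNonzero_of_orientedFactorisation (h₄ : tsuji1999_thm31_colemanMap)
    (h₂ : ferreroWashington_kubotaLeopoldtSeries_unitCoeff) (h₂' : ferreroWashington_stickelbergerSeries_unitCoeff)
    (F : GenusFrame) (θu : ∀ n : ℕ, globalUnitsOf (F.layer n)) (d : OrientedGenusDatum F θu)
    (hK1 : OrientedGenusFactorisationShape d) : GenusResidueNonzeroShape d.toGenusDatum := by
  rw [genusResidueNonzeroShape_iff_not_exists]
  rintro ⟨y, hy⟩
  rcases prime_C_seven.dvd_or_dvd (d.C_seven_dvd_genusFactorM_mul_g h₄ hK1 hy) with h | h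
  · exact d.not_C_seven_dvd_genusFactorM h₂' h
  · exact F.not_C_seven_dvd_g h₂ h

/-- The same, packaged over all frames and oriented data (the form a skeleton consumes by `exact`).
[cite: Tsuji1999, Thm. 3.1 (i) (p. 6)] [cite: Lang1990, Ch. 10 §2 Thm. 2.3 (PDF p. 172)] -/
theorem orientedGenusFactorisationShape_imp_genusResidueNonzeroShape (h₄ : tsuji1999_thm31_colemanMap)
    (h₂ : ferreroWashington_kubotaLeopoldtSeries_unitCoeff) (h₂' : ferreroWashington_stickelbergerSeries_unitCoeff) :
    ∀ (F : GenusFrame) (θu : ∀ n : ℕ, globalUnitsOf (F.layer n)) (d : OrientedGenusDatum F θu),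
      OrientedGenusFactorisationShape d → GenusResidueNonzeroShape d.toGenusDatum :=
  fun F θu d h => genusResidueNonzero_of_orientedFactorisation h₄ h₂ h₂' F θu d h

end Residue

/-! ## §4 (B5) Determinacy: `x`, `Θ`, `Θm` (hence `G_𝔞` up to the branch unit) depend on the frame only -/

section Determinacy

variable {F : GenusFrame} {θu θu' : ∀ n : ℕ, globalUnitsOf (F.layer n)}

/-- **`x` is determined by the frame** (`⋂ⱼ (h_j) = 0` in `Λ`): two data over the same frame — for any global families —
have the same `x`. [cite: Lang1990, Ch. 5 §1 Thm. 1.1 (PDF pp. 115–116, Λ ≅ lim ℤ_p[X]/(ω_n))] -/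
theorem GenusDatum.x_eq (d : GenusDatum F θu) (d' : GenusDatum F θu') : d.x = d'.x :=
  eq_of_forall_sub_mem_span_layerModulus 7 _ d.x_spec d'.x_spec

/-- **`Θ` (Lang's orientation) is determined by the frame**: the congruences (2)–(3) at all levels `7^{n+1}|D|` pin the
series uniquely (`|D|` prime to `7`). [cite: Lang1990, Ch. 10 §1 Thm. 1.2 (PDF pp. 167–168) with Ch. 5 §1 Thm. 1.1] -/
theorem GenusDatum.Theta_eq (d : GenusDatum F θu) (d' : GenusDatum F θu') : d.Θ = d'.Θ :=
  IsStickelbergerSeries.unique 7 F.d_coprime_seven d.Θ_spec d'.Θ_spec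

/-- **`Θm` (the memo's orientation) is determined by the frame.** [cite: Lang1990, Ch. 10 §1 Thm. 1.2 (PDF pp. 167–168) with Ch. 5 §1 Thm. 1.1] -/
theorem OrientedGenusDatum.Thetam_eq (d : OrientedGenusDatum F θu) (d' : OrientedGenusDatum F θu') : d.Θm = d'.Θm :=
  IsStickelbergerSeries.unique 7 F.d_coprime_seven d.Θm_spec d'.Θm_spec

/-- Hence the oriented genus factor depends only on the frame and the branch unit.
[cite: Kato2004Asterisque, §15.5–15.6 (pp. 253–254)] -/
theorem OrientedGenusDatum.genusFactorM_eq (d : OrientedGenusDatum F θu) (d' : OrientedGenusDatum F θu')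
    (hub : d.ub = d'.ub) : d.genusFactorM = d'.genusFactorM := by
  rw [OrientedGenusDatum.genusFactorM_def, OrientedGenusDatum.genusFactorM_def, hub,
    d.toGenusDatum.x_eq d'.toGenusDatum, d.Thetam_eq d']

end Determinacy

/-! ## §5 (B5) Glue for the skeleton: the pen's closed form of K1ᵘ feeds (G6) -/

section Glue

/-- **From the closed form of K1ᵘ (oriented) to the closed form of the residue.**  For ANY pin predicate `P` on the
global family (row B's `IsNormedEllipticUnitFamily`), if every pinned `(F, θu)` carries an oriented datum with K1ᵘ's
identity, then it carries one with the identity AND the non-zero genus residue — given Tsuji 3.1 (i) and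
Ferrero–Washington in both readings.  Conditional glue; nothing about BSD is claimed.
[cite: Tsuji1999, Thm. 3.1 (i) (p. 6)] [cite: Lang1990, Ch. 10 §2 Thm. 2.3 (PDF p. 172)] -/
theorem exists_genusResidueNonzero_of_orientedK1u (h₄ : tsuji1999_thm31_colemanMap)
    (h₂ : ferreroWashington_kubotaLeopoldtSeries_unitCoeff) (h₂' : ferreroWashington_stickelbergerSeries_unitCoeff)
    {P : ∀ F : GenusFrame, (∀ n : ℕ, globalUnitsOf (F.layer n)) → Prop}
    (hK1u : ∀ (F : GenusFrame) (θu : ∀ n : ℕ, globalUnitsOf (F.layer n)), P F θu →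
      ∃ d : OrientedGenusDatum F θu, OrientedGenusFactorisationShape d)
    (F : GenusFrame) (θu : ∀ n : ℕ, globalUnitsOf (F.layer n)) (hP : P F θu) :
    ∃ d : OrientedGenusDatum F θu, OrientedGenusFactorisationShape d ∧ GenusResidueNonzeroShape d.toGenusDatum := by
  obtain ⟨d, hd⟩ := hK1u F θu hP
  exact ⟨d, hd, genusResidueNonzero_of_orientedFactorisation h₄ h₂ h₂' F θu d hd⟩

/-- The same with the datum fixed, in divisibility form (`¬ ∃ y, e_{η₁}θ^𝔞 = 7·y`), the shape a Kummer-side consumer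
(row B, memo (G7′)(1)) starts from. [cite: Tsuji1999, Thm. 3.1 (i) (p. 6)] [cite: Lang1990, Ch. 10 §2 Thm. 2.3 (PDF p. 172)] -/
theorem not_exists_eq_seven_smul_of_orientedFactorisation (h₄ : tsuji1999_thm31_colemanMap)
    (h₂ : ferreroWashington_kubotaLeopoldtSeries_unitCoeff) (h₂' : ferreroWashington_stickelbergerSeries_unitCoeff)
    {F : GenusFrame} {θu : ∀ n : ℕ, globalUnitsOf (F.layer n)} (d : OrientedGenusDatum F θu)
    (hK1 : OrientedGenusFactorisationShape d) :
    ¬ ∃ y : F.U.chiPart F.η₁, d.θ = (C (7 : ℤ_[7]) : IwasawaAlgebra 7) • y :=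
  (genusResidueNonzeroShape_iff_not_exists d.toGenusDatum).mp
    (genusResidueNonzero_of_orientedFactorisation h₄ h₂ h₂' F θu d hK1)

end Glue

/-! ## §6 (B5, continued) The `x`-pin is satisfiable: the `Λ`-adic Artin element `N𝔞 − η₁(N𝔞)σ_{N𝔞}` EXISTS

Appended after `Literature/NumberTheory/IwasawaTheory/IwasawaAlgebraProjectiveLimit.lean` (Lang Ch. 5 §1 Thm 1.1,
surjective half; the order of `u` mod `7^{n+1}`): the item «`x` — the `7`-adic limit `(1+T)^{t}`, `u^{t} = ⟨N𝔞⟩`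
(routine, untyped)» of the (B5) REPORT above is now TYPED AND PROVED — together with `GenusDatum.x_eq` the fields
`x`, `x_spec` of a K1ᵘ witness are uniquely instantiable on every frame.  What remains of the report is unchanged. -/

section ArtinElement

/-- **The `x`-pin of a genus datum is satisfiable**: for every `𝒞₇`-frame there is `x ∈ Λ` with
`x ≡ N𝔞 − η₁(N𝔞)(1+T)^{r_j(N𝔞)} (mod h_j)` for every `j` (the layers are compatible because `u^{r_{j+1}} ≡ u^{r_j}
(mod 7^{j+1})` forces `7ʲ ∣ r_{j+1} − r_j`; `Λ → lim← Λ/(h_j)` is onto).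
[cite: Lang1990, Ch. 5 §1 Thm. 1.1 (PDF pp. 115–116) with Ch. 10 §1 Thm 1.2 (PDF p. 168)] [cite: Kato2004Asterisque, §15.6 (p. 254, N(𝔞) − σ_𝔞)] -/
theorem GenusFrame.exists_x (F : GenusFrame) : ∃ x : IwasawaAlgebra 7, ∀ j : ℕ,
    x - (C (F.normA : ℤ_[7]) - C F.etaOneNormA * (1 + X) ^ (F.r j F.normA)) ∈ Ideal.span {layerModulus 7 j} :=
  F.r_logTable.exists_artinElement (by decide) F.u_topGenerator F.normA_coprime_seven F.etaOneNormA

/-- **… and uniquely so** (`⋂ⱼ (h_j) = 0`): the fields `x`, `x_spec` of a genus datum have exactly one instance on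
each frame. [cite: Lang1990, Ch. 5 §1 Thm. 1.1 (PDF pp. 115–116)] -/
theorem GenusFrame.existsUnique_x (F : GenusFrame) : ∃! x : IwasawaAlgebra 7, ∀ j : ℕ,
    x - (C (F.normA : ℤ_[7]) - C F.etaOneNormA * (1 + X) ^ (F.r j F.normA)) ∈ Ideal.span {layerModulus 7 j} := by
  obtain ⟨x, hx⟩ := F.exists_x
  exact ⟨x, hx, fun y hy => eq_of_forall_sub_mem_span_layerModulus 7 _ hy hx⟩

/-- Hence a datum's `x` IS the frame's Artin element: any `x'` satisfying the pin equals `d.x`.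
[cite: Lang1990, Ch. 5 §1 Thm. 1.1 (PDF pp. 115–116)] -/
theorem GenusDatum.x_eq_of_pin {F : GenusFrame} {θu : ∀ n : ℕ, globalUnitsOf (F.layer n)} (d : GenusDatum F θu)
    {x' : IwasawaAlgebra 7}
    (hx' : ∀ j : ℕ, x' - (C (F.normA : ℤ_[7]) - C F.etaOneNormA * (1 + X) ^ (F.r j F.normA)) ∈
      Ideal.span {layerModulus 7 j}) : d.x = x' :=
  eq_of_forall_sub_mem_span_layerModulus 7 _ d.x_spec hx'

end ArtinElement

/-! ## §7 (B5, continued) The `Θ`-pins are satisfiable: the Stickelberger-branch series EXIST on every frame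

Appended after `Literature/NumberTheory/IwasawaTheory/StickelbergerSeriesExistence.lean` (Lang Ch. 10 Thm 1.2 in the
tree's currency: integrality + distribution relation + projective limit): the item «`Θm`/`Θ` — EXISTENCE of
Iwasawa's Stickelberger series … NOT the passage to `Λ`» of the (B5) REPORT is now TYPED AND PROVED.  Together with
§6, ALL THREE `Λ`-ELEMENTS of a K1ᵘ witness (`x`, `Θ`, `Θm`) exist and are unique on every `𝒞₇`-frame; what remains
of K1ᵘ is the unit side: the projector `e_{η₁}` and the pro-`7` pushes on F4's datum, Sinnott's `cycChi_eq_span`, and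
the (G4) identity with its `Λ`-adic passage (b)(c)(d). -/

section StickelbergerElement

/-- **The parent's `Θ`-pin is satisfiable**: for every `𝒞₇`-frame, Iwasawa's Stickelberger series of the odd branch
`ω⁴χ_D` in Lang's orientation (table `r` of `u`) EXISTS (`θ = η₁ = χ_Dω⁵ ≠ 1` is even, `|D|` is prime to `7`).
[cite: Lang1990, Ch. 10 §1 Thm 1.2 and §2 (2)–(3) (PDF pp. 167–168, 171)] -/
theorem GenusFrame.exists_Theta (F : GenusFrame) :
    ∃ Θ : IwasawaAlgebra 7, IsStickelbergerSeries 7 F.d F.oddBranchSeven F.r Θ :=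
  exists_isStickelbergerSeries (by decide) F.d_coprime_seven F.etaOneDirichlet_ne_one F.etaOneDirichlet_even
    F.ω_teichmuller F.u_topGenerator F.r_logTable

/-- … uniquely. [cite: Lang1990, Ch. 10 §1 Thm 1.2 (PDF pp. 167–168)] -/
theorem GenusFrame.existsUnique_Theta (F : GenusFrame) :
    ∃! Θ : IwasawaAlgebra 7, IsStickelbergerSeries 7 F.d F.oddBranchSeven F.r Θ :=
  existsUnique_isStickelbergerSeries (by decide) F.d_coprime_seven F.etaOneDirichlet_ne_one F.etaOneDirichlet_even
    F.ω_teichmuller F.u_topGenerator F.r_logTable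

/-- **The oriented `Θm`-pin is satisfiable**: the Stickelberger series in the MEMO's orientation (table `rInv` of
`u⁻¹`) EXISTS on every frame. [cite: Lang1990, Ch. 10 §1 Thm 1.2 and §2 (2)–(3) (PDF pp. 167–168, 171)] -/
theorem GenusFrame.exists_Thetam (F : GenusFrame) :
    ∃ Θ : IwasawaAlgebra 7, IsStickelbergerSeries 7 F.d F.oddBranchSeven F.rInv Θ :=
  exists_isStickelbergerSeries (by decide) F.d_coprime_seven F.etaOneDirichlet_ne_one F.etaOneDirichlet_even
    F.ω_teichmuller F.isTopGenerator_u_inv F.rInv_logTable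

/-- … uniquely. [cite: Lang1990, Ch. 10 §1 Thm 1.2 (PDF pp. 167–168)] -/
theorem GenusFrame.existsUnique_Thetam (F : GenusFrame) :
    ∃! Θ : IwasawaAlgebra 7, IsStickelbergerSeries 7 F.d F.oddBranchSeven F.rInv Θ :=
  existsUnique_isStickelbergerSeries (by decide) F.d_coprime_seven F.etaOneDirichlet_ne_one F.etaOneDirichlet_even
    F.ω_teichmuller F.isTopGenerator_u_inv F.rInv_logTable

/-- A datum's `Θ` IS the frame's (Lang-oriented) Stickelberger element: any `Θ'` satisfying the pin equals `d.Θ`.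
[cite: Lang1990, Ch. 10 §1 Thm 1.2 (PDF pp. 167–168)] -/
theorem GenusDatum.Theta_eq_of_pin {F : GenusFrame} {θu : ∀ n : ℕ, globalUnitsOf (F.layer n)}
    (d : GenusDatum F θu) {Θ' : IwasawaAlgebra 7} (h : IsStickelbergerSeries 7 F.d F.oddBranchSeven F.r Θ') :
    d.Θ = Θ' :=
  IsStickelbergerSeries.unique 7 F.d_coprime_seven d.Θ_spec h

/-- Hence an oriented datum's `Θm` IS the frame's Stickelberger element: any `Θ'` satisfying the pin equals `d.Θm`.
[cite: Lang1990, Ch. 10 §1 Thm 1.2 (PDF pp. 167–168)] -/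
theorem OrientedGenusDatum.Thetam_eq_of_pin {F : GenusFrame} {θu : ∀ n : ℕ, globalUnitsOf (F.layer n)}
    (d : OrientedGenusDatum F θu) {Θ' : IwasawaAlgebra 7}
    (h : IsStickelbergerSeries 7 F.d F.oddBranchSeven F.rInv Θ') : d.Θm = Θ' :=
  IsStickelbergerSeries.unique 7 F.d_coprime_seven d.Θm_spec h

end StickelbergerElement

end Summit.BirchSwinnertonDyer.Rank1Residual.Additive.GenusSeven

end
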